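import Literature.GroupTheory.CombinatorialGroupTheory.FibredTranslationCocycles
import HarnessLib

/-!
# Fibred translations of `Q × M`, II: orbit cocycles with controlled values and their superposition

Topic `Literature/GroupTheory/CombinatorialGroupTheory`; PROOF-ONLY (0 definitions).  Sequel to
`FibredTranslationCocycles.lean` for the LOOP node of the irreducible nodal degeneration ([CombGC] Prop. 1.2,
proof p. 9, "gluing together appropriate finite étale coverings of the anabelioids `G_v`, `G_e`"
[cite: MochizukiCombGC2007, Prop 1.2 proof p.9]; consumer `PuncturedSurfaceGroupLoopTwist.lean`): there the
block of the loop handle carries TWO opposite charges, which one far handle must cancel, so two orbit cocycles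
are superposed on one letter.

* `NodeTwist.twist_comm_apply'` — the commutator cocycle of two fibred translations with ARBITRARY cocycles;
* `NodeTwist.exists_orbitCocycle_mem` — the orbit cocycle of `exists_orbitCocycle`, with its values recorded in
  any subgroup `C ∋ Y` normalised by `X` (for the Heisenberg group: the abelian normal subgroup `⟨Y, Z⟩`);
* `NodeTwist.orbitDeriv_mul` — **superposition**: for `C` abelian and normalised by `X`, the `v`-derivative
  `α ↦ α(vt)·X·α(t)⁻¹·X⁻¹` is multiplicative on `C`-valued cocycles, so two orbit cocycles on the SAME letter
  give two independent charges (same `⟨v⟩`-orbit or not).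

Folklore group theory; nothing here bears on [IUTchIII] Cor. 3.12.
-/

namespace Literature.GroupTheory.CombinatorialGroupTheory

namespace NodeTwist

variable {Q M : Type*} [Group Q] [Group M]

/-- **The commutator of two fibred translations, general cocycles**:
`[σ_a, σ_b](p, m) = ([u,v]·p, α(v u⁻¹ v⁻¹ p) · β(u⁻¹ v⁻¹ p) · α(u⁻¹ v⁻¹ p)⁻¹ · β(v⁻¹ p)⁻¹ · m)`.
[cite: MochizukiCombGC2007, Prop 1.2 proof p.9] -/
theorem twist_comm_apply' {σa σb : Equiv.Perm (Q × M)} {u v : Q} {α β : Q → M}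
    (ha : ∀ p m, σa (p, m) = (u * p, α p * m)) (hb : ∀ p m, σb (p, m) = (v * p, β p * m))
    (p : Q) (m : M) :
    (σa * σb * σa⁻¹ * σb⁻¹) (p, m) =
      (u * v * u⁻¹ * v⁻¹ * p,
        α (v * (u⁻¹ * (v⁻¹ * p))) * β (u⁻¹ * (v⁻¹ * p)) * (α (u⁻¹ * (v⁻¹ * p)))⁻¹ * (β (v⁻¹ * p))⁻¹ * m) := by
  rw [Equiv.Perm.mul_apply, Equiv.Perm.mul_apply, Equiv.Perm.mul_apply,
    twist_inv_apply hb, twist_inv_apply ha, hb, ha]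
  simp only [mul_assoc]

/-- **Superposition of `v`-derivatives**: for cocycles with values in a commutative subgroup `C` normalised
by `X`, the `v`-derivative `α ↦ α(v t) X α(t)⁻¹ X⁻¹` of a pointwise product is the product of the derivatives.
[cite: MochizukiCombGC2007, Prop 1.2 proof p.9] -/
theorem orbitDeriv_mul (C : Subgroup M) (hC : ∀ y ∈ C, ∀ y' ∈ C, y * y' = y' * y)
    (X : M) (hXC : ∀ y ∈ C, X * y * X⁻¹ ∈ C) {αA αB : Q → M} (hA : ∀ t, αA t ∈ C) (hB : ∀ t, αB t ∈ C)
    (v t : Q) :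
    αA (v * t) * αB (v * t) * X * (αA t * αB t)⁻¹ * X⁻¹ =
      (αA (v * t) * X * (αA t)⁻¹ * X⁻¹) * (αB (v * t) * X * (αB t)⁻¹ * X⁻¹) := by
  have hA' : X * (αA t)⁻¹ * X⁻¹ ∈ C := hXC _ (C.inv_mem (hA t))
  have hB' : X * (αB t)⁻¹ * X⁻¹ ∈ C := hXC _ (C.inv_mem (hB t))
  calc αA (v * t) * αB (v * t) * X * (αA t * αB t)⁻¹ * X⁻¹
      = αA (v * t) * (αB (v * t) * ((X * (αB t)⁻¹ * X⁻¹) * (X * (αA t)⁻¹ * X⁻¹))) := by group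
    _ = αA (v * t) * (αB (v * t) * ((X * (αA t)⁻¹ * X⁻¹) * (X * (αB t)⁻¹ * X⁻¹))) := by rw [hC _ hB' _ hA']
    _ = αA (v * t) * ((αB (v * t) * (X * (αA t)⁻¹ * X⁻¹)) * (X * (αB t)⁻¹ * X⁻¹)) := by simp only [mul_assoc]
    _ = αA (v * t) * (((X * (αA t)⁻¹ * X⁻¹) * αB (v * t)) * (X * (αB t)⁻¹ * X⁻¹)) := by
        rw [hC _ (hB (v * t)) _ hA']
    _ = (αA (v * t) * X * (αA t)⁻¹ * X⁻¹) * (αB (v * t) * X * (αB t)⁻¹ * X⁻¹) := by simp only [mul_assoc]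

/-- **The orbit cocycle with controlled values** (cf. `exists_orbitCocycle`): for `Y` in a subgroup `C`
normalised by `X`, the orbit cocycle `α(v^k p₀) = X^k Y X^{−k}` (else `1`) takes values in `C`, and its
`v`-derivative is `[Y, X^{ord v}]` at `t = v⁻¹ p₀` and `1` elsewhere. [cite: MochizukiCombGC2007, Prop 1.2 proof p.9] -/
theorem exists_orbitCocycle_mem [Finite Q] [DecidableEq Q] (v p₀ : Q) (X Y : M) (C : Subgroup M)
    (hXC : ∀ y ∈ C, X * y * X⁻¹ ∈ C) (hY : Y ∈ C) :
    ∃ α : Q → M, (∀ t, α t ∈ C) ∧ ∀ t : Q,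
      α (v * t) * X * (α t)⁻¹ * X⁻¹ =
        if t = v⁻¹ * p₀ then Y * X ^ orderOf v * Y⁻¹ * (X ^ orderOf v)⁻¹ else 1 := by
  have hv : IsOfFinOrder v := isOfFinOrder_of_finite v
  set L := orderOf v with hL
  have hLpos : 0 < L := hv.orderOf_pos
  let e := finEquivZPowers hv
  -- discrete logarithm on `⟨v⟩`
  let lg : ∀ d : Q, d ∈ Subgroup.zpowers v → ℕ := fun d hd => (e.symm ⟨d, hd⟩ : ℕ)
  have hlg_lt : ∀ d hd, lg d hd < L := fun d hd => (e.symm ⟨d, hd⟩).isLt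
  have hlg_pow : ∀ d hd, v ^ lg d hd = d := fun d hd => pow_finEquivZPowers_symm_apply hv ⟨d, hd⟩
  have hlg_of_pow : ∀ (n : ℕ) (hd : v ^ n ∈ Subgroup.zpowers v), lg (v ^ n) hd = n % L := by
    intro n hd
    have heq : (⟨v ^ n, hd⟩ : Subgroup.zpowers v) = ⟨v ^ n, ⟨n, by simp⟩⟩ := Subtype.ext rfl
    change ((e.symm ⟨v ^ n, hd⟩ : Fin L) : ℕ) = n % L
    rw [heq]
    exact congrArg Fin.val (finEquivZPowers_symm_apply hv n)
  have hlg_congr : ∀ d₁ d₂ hd₁ hd₂, d₁ = d₂ → lg d₁ hd₁ = lg d₂ hd₂ := by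
    rintro d₁ d₂ hd₁ hd₂ rfl; rfl
  let α : Q → M := fun t =>
    if hd : t * p₀⁻¹ ∈ Subgroup.zpowers v then
      X ^ lg (t * p₀⁻¹) hd * Y * (X ^ lg (t * p₀⁻¹) hd)⁻¹ else 1
  have hα_mem : ∀ t (hd : t * p₀⁻¹ ∈ Subgroup.zpowers v),
      α t = X ^ lg (t * p₀⁻¹) hd * Y * (X ^ lg (t * p₀⁻¹) hd)⁻¹ := fun t hd => dif_pos hd
  have hα_not : ∀ t, t * p₀⁻¹ ∉ Subgroup.zpowers v → α t = 1 := fun t hd => dif_neg hd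
  have hconj : ∀ k : ℕ, X ^ k * Y * (X ^ k)⁻¹ ∈ C := by
    intro k
    induction k with
    | zero => simpa using hY
    | succ k ih =>
      have h := hXC _ ih
      rw [pow_succ', mul_inv_rev]
      simpa only [mul_assoc] using h
  refine ⟨α, fun t => ?_, fun t => ?_⟩
  · by_cases hd : t * p₀⁻¹ ∈ Subgroup.zpowers v
    · rw [hα_mem t hd]; exact hconj _
    · rw [hα_not t hd]; exact C.one_mem
  by_cases hd : t * p₀⁻¹ ∈ Subgroup.zpowers v
  · -- on the orbit: `t p₀⁻¹ = v^k`
    set k := lg (t * p₀⁻¹) hd with hk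
    have hkL : k < L := hlg_lt _ hd
    have hvk : v ^ k = t * p₀⁻¹ := hlg_pow _ hd
    have hvt : v * t * p₀⁻¹ = v ^ (k + 1) := by rw [pow_succ', hvk, mul_assoc]
    have hd' : v * t * p₀⁻¹ ∈ Subgroup.zpowers v := by rw [hvt]; exact ⟨k + 1, zpow_natCast v _⟩
    have hlg' : lg (v * t * p₀⁻¹) hd' = (k + 1) % L := by
      rw [hlg_congr _ _ hd' (hvt ▸ hd') hvt, hlg_of_pow]
    rw [hα_mem (v * t) hd', hlg', hα_mem t hd, ← hk]
    by_cases hwrap : k + 1 = L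
    · -- the wrap point `t = v⁻¹ p₀`
      have h1 : v * t * p₀⁻¹ = 1 := by rw [hvt, hwrap, hL, pow_orderOf_eq_one]
      have ht : t = v⁻¹ * p₀ := by
        rw [eq_inv_mul_iff_mul_eq]
        exact mul_inv_eq_one.mp h1
      rw [if_pos ht, hwrap, Nat.mod_self, pow_zero, inv_one, mul_one, one_mul, ← hwrap]
      simp only [mul_inv_rev, inv_inv, pow_succ]
      group
    · -- a generic point of the orbit
      have hlt : k + 1 < L := lt_of_le_of_ne hkL hwrap
      have hne : t ≠ v⁻¹ * p₀ := by
        intro ht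
        have h1 : v ^ (k + 1) = 1 := by
          rw [← hvt, ht, ← mul_assoc, mul_inv_cancel, one_mul, mul_inv_cancel]
        have h2 : L ∣ k + 1 := hL ▸ orderOf_dvd_of_pow_eq_one h1
        exact absurd (Nat.le_of_dvd (Nat.succ_pos k) h2) (not_le.mpr hlt)
      rw [if_neg hne, Nat.mod_eq_of_lt hlt]
      simp only [mul_inv_rev, inv_inv, pow_succ]
      group
  · -- off the orbit
    have hd' : v * t * p₀⁻¹ ∉ Subgroup.zpowers v := fun h => hd (by
      have h2 := Subgroup.mul_mem _ (Subgroup.inv_mem _ (Subgroup.mem_zpowers v)) h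
      rwa [mul_assoc, inv_mul_cancel_left] at h2)
    have hne : t ≠ v⁻¹ * p₀ := by
      rintro rfl
      exact hd (by rw [mul_assoc, mul_inv_cancel, mul_one]; exact Subgroup.inv_mem _ (Subgroup.mem_zpowers v))
    rw [hα_not _ hd', hα_not _ hd, if_neg hne, inv_one, mul_one, one_mul, mul_inv_cancel]


end NodeTwist

end Literature.GroupTheory.CombinatorialGroupTheory
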